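import Literature.MathematicalPhysics.QuantumFieldTheory.Balaban1983to89.B8Prop7AdmittedFamily
import Literature.MathematicalPhysics.QuantumFieldTheory.Balaban1983to89.B8Ineq145Lineage
import Literature.MathematicalPhysics.QuantumFieldTheory.Balaban1983to89.B8Prop7ClassAkLocal

/-!
# `Balaban1983to89.B8Prop7HalfSpace` — [Balaban1985RegularSpaces] **Proposition 7** (p. 100, (1.144)–(1.145)) for the
# HALF-SPACE family `Ω₀ = T_η ⊃ Ω₁ = {x : 0 ≤ x_{i₀}}` (`k = 1`): the REPAIRED leaf `B8Ineq145.Prop7RepairedC (C(d, L))` HOLDS and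
# the typed PRINTED leaf `B8SectGH.Prop7PrintedR` (constant `2α₂`) FAILS — both for one and the same `GFData3` packaging of
# the lineage's `ℤᵈ` carriers (the located erratum G-B8-01 of the cell, in both directions, on one family)

statement-level skeleton of published theorems with citation tags; proofs where landed; nothing here is a claim about the Yang–Mills mass gap

T. Bałaban, *Spaces of regular gauge field configurations on a lattice and gauge fixing conditions*, Commun. Math. Phys. **99** (1985)
75–102 `[Balaban1985RegularSpaces]` ("B8"; printed page = PDF page + 74; PDF held `paper:balaban1985-cmp99-regular-spaces-gauge-fixing`,
pp. 77, 79, 81–82, 100 read in the text layer).  "[3]" = T. Bałaban, *Averaging operations for lattice gauge theories*, Commun. Math.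
Phys. **98** (1985) 17–51 `[Balaban1985Averaging]` ("B7").  STATUS: published, refereed.  This file ASSEMBLES Proposition 7 for the
half-space family from pieces certified in the tree; nothing here is new mathematics and nothing here is a claim about the Clay
problem.  Unit `lit-balaban-r05` gen 8 (B8 fold owner; HOME `run/shared/lean/pub/lit-balaban/`; SKELETON row **B8.Prop7**; cell GAPS
**G-B8-01**), 2026-08-21.

## THE PRINTED TEXT (p. 100 [PDF 26], verbatim)

*"We assume that we are given a gauge field configuration U₀, U₀ ∈ 𝔄_k({Ω_j}, α₀), (1.139) and a Lie algebra valued configuration A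
satisfying L^jη|A|, (L^jη)²|∇^η_{U₀}A|, (L^jη)³|D^{η*}_{U₀}D^η_{U₀}A| < α₂ on Ω_j. (1.140)  We consider the configuration U₁U₀, U₁ =
e^{iηA}."* … *"Let us take a gauge transformation u satisfying the conditions (1.29) and such that the configuration U′ =
(U₁U₀)^u U₀⁻¹ satisfies the axial gauge conditions (1.19). This gauge transformation is determined uniquely. The above bounds imply
the following* **Proposition 7.** *If the configurations U₀, A satisfy (1.139), (1.140), then for α₀, α₂ sufficiently small we have
U′U₀ = (U₁U₀)^u ∈ 𝔄_k({Ω_j}, α₀ + 3α₂) ∩ Ax_k(𝔅_k, U₀), (1.144)  |(U′U₀)‾^j − Ū₀^j| = |exp iQ_j(U₀, ηA) − 1| < 2α₂ on Ω^{(j)}_j. (1.145)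
This theorem complements Theorem 2."*  Conventions: p. 77 (1.3)–(1.6) (admissible sequences `Ω₀ ⊃ Ω₁ ⊃ … ⊃ Ω_k`, each `Ω_j` a union of
big blocks; `Λ_j = Ω_j^{(j)} ∖ Ω_{j+1}^{(j)}`, `Λ_k = Ω_k^{(k)}`), p. 77 bond convention (*"we denote by Ω also the set of bonds … at least
one end-point of b belongs to Ω"*), p. 81 (1.29)–(1.31), p. 82 (1.35) *"|(\overline{U′U₀})ʲ − Ū₀ʲ| < α₁ on Λ_j, j = 0, 1, …, k"* (the
hypothesis of Theorem 2 that (1.145) feeds).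

## THE FAMILY AND WHAT IS CERTIFIED

The HALF-SPACE family of r05 g6's `B8Ineq145Lineage` §3: `k = 1`, `Ω₀ = T_η ↦ ℤᵈ`, `Ω₁ = {x : 0 ≤ x_{i₀}}` (a union of `L`-blocks for
every `L`, so (1.3)–(1.4) hold with `R = ∞`; `OmegaHS`), hence (1.5) `Λ₁ = Ω₁^{(1)} = {z : 0 ≤ z_{i₀}}`, `Λ₀ = {x : x_{i₀} < 0}`
(`B8Ineq145Lineage.Lam`), and print's gauge transformation `u = B8Ineq145Lineage.u8` (the gauge fixing `glev` of [3] on `Ω₁`, `1` on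
`Λ₀`; (1.29) `restr129_u8`, (1.19) `inAx_u8`, both for EVERY `U₀, U₁`).  On this family the level-1 lattice has bonds CROSSING `∂Λ₁`
(`b = ⟨z, z + e_{i₀}⟩`, `z_{i₀} = −1`: the block `B(b₋)` lies in `Λ₀`, `b₊ ∈ Λ₁`), which the admitted family «Ω_j = T_η» of gen 7's `B8Prop7AdmittedFamily` has not: there the typed
printed leaf holds (`prop7PrintedR_admitted`), here it FAILS (§5, the witness of `B8Ineq145Lineage.ineq145_fails_lineage`: `d = 4`,
`L = 3`, `𝔸 = ℂ`, `U₀ = 1`, `U₁ ≡ e^{iθ}`, `Lθ = (27/28)α₂`), while the REPAIRED leaf `Prop7RepairedC C` ((1.145) ↦ (1.35) on `Λ_j` with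
constant `C·α₂`) HOLDS with `C = C(d, L) = 202·d·L` (§4) — for every `d ≥ 2`, `L ≥ 2`, `i₀`, `η > 0`, every C⋆-algebra `𝔸` with
`G = U(𝔸)`.  The hypotheses are print's LEVEL-WISE (1.139) `U₀ ∈ 𝔄_1({Ω_j}, α₀)` (`B8Ineq132.InAk … OmegaHS`) and (1.140) «on Ω_j»,
`j = 0, 1`, in p40 g5's located reading `B8Eq140Level.Cond140 L η α₂ j (Ω_j) U₀ A` (all three members; GAPS G-B8-16).

* §1 geometry: `OmegaHS`, the bond classes of `Λ₀`/`Λ₁` (`bondTouches_lam_zero`: a level-0 bond on `Λ₀` has `b₋ ∈ Λ₀`, so `u(b₋) = 1`;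
  `bondTouches_lam_one`: a level-1 bond on `Λ₁` is INTERIOR (`0 ≤ z_{i₀}`) or CROSSING (`z_{i₀} = −1`, direction `i₀`)).
* §2 «for α₀, α₂ sufficiently small»: `cHS d L = cst d L / L²` (gen 7's window divided by `L²`: the Prop.-2/Prop.-4 windows of [3] @gen
  are entered with the GLOBAL level-0 thresholds of (1.139)/(1.140), the only ones valid on all of `Λ₀`; print: *"c₁ depends on d, L"*).
* §3 (standing data of `B8Prop7AdmittedFamily` §1/§3 at `k = 1`, `sup|B| ≤ b`): `u8_mem_unitaryUnits` (print's `u` is `U(𝔸)`-valued),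
  `norm_u8_sub_one_le` (`|u − 1| ≤ 200dLb`, gen 7's `norm_glev_sub_one_le`); the three bond classes of (1.145) ↦ (1.35):
  **`norm_avgIter_u8_sub_le_zero`** (level 0, bonds on `Λ₀`: `(U′U₀)_b − U₀,b = (U₁,b·R(U₀,b)u(b₊)⁻¹ − 1)U₀,b`, `≤ b + 200dLb`),
  **`norm_avgIter_u8_sub_le_interior`** (level 1, `b₋, b₊ ∈ Λ₁`: `Ũ′¹_b = (U̿₁¹)_b` by p. 81 / (92) of [3] — r05 g5's
  `B8Eq131Derivation.eq130_interior` with (87) at both ends from the definition of `u8` —, `≤ 2Lb` by (161)/(1.143)+(24)),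
  **`norm_avgIter_u8_sub_le_crossing`** (level 1, crossing: `Ũ′¹_b = \overline{R_{0,b₋}U₁}·(U̿₁¹)_b` — r05 g6's `tildIter_u8_crossing`,
  the second line of (1.31) —, the block frame (82) being `v₁(b₋)` of (97), within `64dLb` of `1` by (163) @gen
  (`norm_vcov_sub_one_le`): `≤ 64dLb + 2Lb`); **`norm_avgIter_u8_sub_le`**: all bonds of `Λ_j`, `j = 0, 1`: `≤ 201dLb`.
* §4 `standingHS` (the standing data from (1.139)/(1.140) level-wise: `b = α₂`, (52) for `U₀` at `2L²α₀` and for `U₁U₀` at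
  `2L²(α₀ + 3α₂)` from the LEVEL-0 clauses and p40's `B8Prop7ClassAkLocal.inAk_mulCfg_hermitian_loc`), the packaging
  **`halfspaceGF L i₀ 𝔸 : {η > 0} → B8SectGH.GFData3`**, **`toAxialHS`** (`U₁ ↦ U′ = U₁^{u8}`), **`prop7_halfspace_explicit`** (all inputs
  explicit: `u` unitary-valued; (1.144) `𝔄_k`-clause = p40 g5's `inAk_mulCfg_gaugeAct_hermitian_loc` BY NAME; (1.144) `Ax_k`-clause
  `inAx_u8`; (1.29) `restr129_u8`; (1.145) ↦ (1.35) `≤ 201dL·α₂` on every bond of `Λ_j`, `j = 0, 1`),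
  **`prop7RepairedC_halfspace : B8Ineq145.Prop7RepairedC (202·d·L) (halfspaceGF L i₀ 𝔸) (toAxialHS L _ i₀ 𝔸)`**, `…_of_le` (every
  `C ≥ 202dL`).
* §5 **`not_prop7PrintedR_halfspace : ¬ B8SectGH.Prop7PrintedR (halfspaceGF 3 0 ℂ) (toAxialHS 3 _ 0 ℂ)`** (`d = 4`) and the
  conjunction **`prop7_halfspace_located`** (`d = 4`, `L = 3`, `𝔸 = ℂ`: printed leaf false, repaired leaf `C = 2424` true).

## HONEST SCOPE — what is NOT claimed

(i) Dictionary as in `B8Prop7AdmittedFamily` (i): `T_η ↦ ℤᵈ`, `η > 0` explicit, `G = U(𝔸)`, `A` Hermitian, `U₁ = e^{iηA}`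
(`B8Eq146AExpansion.iEta`/`expCfg`), (1.140) in p40's located reading `Cond140` (one plaquette layer wider than the bond convention
for the `|A|`, `|∇A|` members; GAPS G-B8-16); `d ≥ 2` (a second lattice direction is used to read the level-0 member of (1.140) on
every bond).  (ii) ONE admissible family per `(i₀, η)` at `k = 1` — the simplest family with a non-empty `∂Λ_j`; the general
admissible `{Ω_j}` of (1.3)/(1.4) (arbitrary `k`, cubes of size `≥ R`) is not treated.  (iii) (1.145) is read, as in all typed leaves
(`B8.Prop7Printed`, `B8SectGH.Prop7PrintedR`, `B8Ineq145.Prop7RepairedC`; pv17 DIVERGENCE D-pv17.4), through the (1.35)-predicate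
`avgClose` «on Λ_j» (bond convention of p. 77: at least one end in `Λ_j`), `j = 0, 1`.  (iv) THE CONSTANT `C = 202·d·L` is this
file's bookkeeping with gen 7's global bounds (`u` within `200dLb`, `v₁` within `64dLb`, `U̿₁¹` within `2Lb` of `1`, `b = sup η|A| =
α₂` from the level-0 member of (1.140)); it is NOT optimised (the witness of §5 shows only `C > 2`; the cell's adjudicated sharp
constants `2dL` / `2 + d(L−1)/2 + …` of `B8Ineq145` §3 would need bond-by-bond locality of the averages, not reproduced).  (v) «for α₀, α₂
sufficiently small» ↦ `cHS d L = cst d L / L²` explicitly (`cst` = gen 7's minimum of the input windows).  (vi) The fields of `GFData3`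
not read by Proposition 7 ((1.36)–(1.39), (1.62), (1.66), (1.146), (3.35), `act`, `fNorm`, `fGrad`, `InR`) are trivial data on these
carriers, exactly as in `B8Ineq145Lineage.lineageGF7`/`B8Prop7AdmittedFamily.admittedGF`.  (vii) Uniqueness of `u` (*"determined
uniquely"*) is not re-derived here (the leaves abstract `u` into `toAxial`; cf. `B7Eq84Concrete.gaugeFixing_unique`).

[cite: Balaban1985RegularSpaces, Prop. 7 (1.144)–(1.145) p.100, (1.139)–(1.140) p.100, (1.143) p.100, (1.29)–(1.31) pp.81–82,
(1.19)–(1.20) p.79, (1.17) p.78, (1.35) p.82, (1.3)–(1.6) p.77, p.77 (bond convention); Balaban1985Averaging, (52) p.26, (55) p.27,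
(69) p.29, (76)–(77) pp.29–30, (81)–(88) pp.30–31, (89)–(92) p.31, (97) p.32, (159)–(163) p.42, (22)–(24) p.21]
-/

noncomputable section

open scoped BigOperators
open NormedSpace Finset

namespace Literature.MathematicalPhysics.QuantumFieldTheory.Balaban1983to89.B8Prop7HalfSpace

open B7Prop1Explicit B7Prop2Explicit B7Prop3Flat MatrixLog B7Eq92Concrete B7Eq99Concrete B7Eq84Concrete B7AvgGaugeCovariance
open B7Prop8PrintedConstants (norm_exp_sub_one_le_of_mem_unitary Rc_mem_unitaryUnits)
open B8Lemma1NonAbelian (mulCfg norm_units_mul_sub_one_le)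
open B8Eq146AExpansion (iEta plaqCovDeriv plaqCovDeriv_eq_covDerivFwd norm_iEta_le)
open B8Eq143PlaqExpansion (pdiv)
open B8Ineq132 (InAk CondAt BondTouches PlaqTouches plaqF covDiv covDerivFwd covDeriv)
open B8Eq119TwistedAxial (InAx Restr129)
open B8Eq131Derivation (eq130_interior)
open B8Eq155JBound (expCfg_iEta_mem_unitaryUnits expCfg_iEta_mem_U1)
open B8Ineq1144TwistedAxial (pdev_le_of_forall)
open B8Eq140Level (SideTouches Cond140 sideTouches_of_bondTouches)
open B8Prop7ClassAkLocal (inAk_mulCfg_hermitian_loc inAk_mulCfg_gaugeAct_hermitian_loc)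
open B8Prop7AdmittedFamily (cst cst_pos glev_mem_unitaryUnits avgIter_mem_unitaryUnits dbavgCovIter_vcov_mem_unitaryUnits
  norm_dbavgCovIter_sub_one_le norm_vcov_sub_one_le norm_glev_sub_one_le mgauge_mul_eq_gaugeAct_mulCfg)
open B8Ineq145Lineage (Lam mem_Lam_zero mem_Lam_one u8 u8_of_neg restr129_u8 inAx_u8 tildIter_u8_crossing eI hyp139
  hyp140_grad ineq145_fails_lineage)

-- `Site` alone would resolve to the torus sites of `Setup.lean`; re-export the `ℤ^d` sites of `B7Prop1Explicit`.
export B7Prop1Explicit (Site)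

variable {d : ℕ}

/-! ## §1 The half-space family: domains (1.3)–(1.6) and its bond classes -/

section Geometry

/-- **The admissible sequence of the half-space family** (p. 77 (1.3)–(1.4), `k = 1`): `Ω₀ = T_η ↦ ℤᵈ`, `Ω₁ = {x : 0 ≤ x_{i₀}}` (a
union of `L`-blocks `B¹(y)`, `0 ≤ y_{i₀}`, for every `L`; (1.4) with `R = ∞`), no further domains.  Its sets (1.5) are
`B8Ineq145Lineage.Lam i₀`: `Λ₁ = Ω₁^{(1)} = {z : 0 ≤ z_{i₀}}`, `Λ₀ = Ω₀ ∖ B(Λ₁) = {x : x_{i₀} < 0}`.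
[cite: Balaban1985RegularSpaces, (1.3)–(1.6) p.77] -/
def OmegaHS (i₀ : Fin d) : ℕ → Set (Site d)
  | 0 => Set.univ
  | 1 => {x | 0 ≤ x i₀}
  | _ + 2 => ∅

/-- `Ω₀ = T_η`. [cite: Balaban1985RegularSpaces, (1.3) p.77] -/
@[simp] theorem omegaHS_zero (i₀ : Fin d) : OmegaHS i₀ 0 = Set.univ := rfl

/-- `Ω₁ = {x : 0 ≤ x_{i₀}}`. [cite: Balaban1985RegularSpaces, (1.3) p.77] -/
@[simp] theorem omegaHS_one (i₀ : Fin d) : OmegaHS i₀ 1 = {x | 0 ≤ x i₀} := rfl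

/-- Every bond is «on Ω₀» and every plaquette is «on Ω₀» (p. 77 convention; `Ω₀ = T_η`).
[cite: Balaban1985RegularSpaces, p.77 (bond convention)] -/
theorem bondTouches_omegaHS_zero (i₀ : Fin d) (x : Site d) (μ : Fin d) : BondTouches (OmegaHS i₀ 0) x μ :=
  Or.inl (Set.mem_univ x)

/-- Every plaquette is «on Ω₀». [cite: Balaban1985RegularSpaces, p.77 (plaquette convention)] -/
theorem plaqTouches_omegaHS_zero (i₀ : Fin d) (x : Site d) (μ ν : Fin d) : PlaqTouches (OmegaHS i₀ 0) x μ ν :=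
  Or.inl (Set.mem_univ x)

/-- With a second direction (`d ≥ 2`) every bond is a side of a plaquette «on Ω₀» — the set on which p40's located reading of
(1.140) reads `|A|` and `|∇A|` at level `0`. [cite: Balaban1985RegularSpaces, (1.140) p.100, p.77 (conventions)] -/
theorem sideTouches_omegaHS_zero (hd : 2 ≤ d) (i₀ : Fin d) (y : Site d) (τ : Fin d) : SideTouches (OmegaHS i₀ 0) y τ := by
  -- a direction `κ ≠ τ` exists since `d ≥ 2`
  have h0 : 0 < d := by omega
  have h1 : 1 < d := by omega
  by_cases hτ : (τ : ℕ) = 0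
  · exact sideTouches_of_bondTouches (κ := ⟨1, h1⟩) (fun h => by simp [Fin.ext_iff, hτ] at h)
      (bondTouches_omegaHS_zero i₀ y τ)
  · exact sideTouches_of_bondTouches (κ := ⟨0, h0⟩) (fun h => by simp [Fin.ext_iff] at h; omega)
      (bondTouches_omegaHS_zero i₀ y τ)

/-- **The level-0 bonds «on Λ₀»** (at least one end in `Λ₀ = {x : x_{i₀} < 0}`): their lower end `b₋ = x` lies in `Λ₀` (the
positively oriented bond `⟨x, x + e_μ⟩` cannot re-enter `Λ₀` from `B(Λ₁) = {x_{i₀} ≥ 0}`). [cite: Balaban1985RegularSpaces, (1.5)–(1.6) p.77, p.77 (bond convention)] -/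
theorem bondTouches_lam_zero {i₀ : Fin d} {x : Site d} {μ : Fin d} (h : BondTouches (Lam i₀ 0) x μ) : x i₀ < 0 := by
  rcases h with h | h
  · exact (mem_Lam_zero i₀ x).1 h
  · have h' := (mem_Lam_zero i₀ (x + e μ)).1 h
    simp only [Pi.add_apply, e_apply] at h'
    split_ifs at h' <;> omega

/-- **The level-1 bonds «on Λ₁»** (`Λ₁ = {z : 0 ≤ z_{i₀}}`): a bond `⟨z, z + e_κ⟩` with an end in `Λ₁` is either INTERIOR (`b₋ ∈ Λ₁`,
hence `b₊ ∈ Λ₁`: the first line of (1.31)) or CROSSING (`b₋ ∉ Λ₁`, `b₊ ∈ Λ₁`: `κ = i₀`, `z_{i₀} = −1`; the second line of (1.31)).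
[cite: Balaban1985RegularSpaces, (1.31) p.82, (1.5) p.77, p.77 (bond convention)] -/
theorem bondTouches_lam_one {i₀ : Fin d} {z : Site d} {κ : Fin d} (h : BondTouches (Lam i₀ 1) z κ) :
    0 ≤ z i₀ ∨ (z i₀ = -1 ∧ κ = i₀) := by
  rcases h with h | h
  · exact Or.inl ((mem_Lam_one i₀ z).1 h)
  · have h' := (mem_Lam_one i₀ (z + e κ)).1 h
    simp only [Pi.add_apply, e_apply] at h'
    by_cases hκ : i₀ = κ
    · rw [if_pos hκ] at h'
      by_cases hz : 0 ≤ z i₀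
      · exact Or.inl hz
      · exact Or.inr ⟨by omega, hκ.symm⟩
    · rw [if_neg hκ] at h'
      exact Or.inl (by omega)

variable (L : ℕ) (i₀ : Fin d)

/-- The block points `L•z`, `L•z + r` (`r ∈ [0, L)ᵈ`) and `L•(z + e_κ)` under/next to a `Λ₁`-site `z` lie in `Ω₁`. [folklore] -/
private theorem smul_nonneg_of {z : Site d} (hz : 0 ≤ z i₀) : 0 ≤ ((L : ℤ) • z) i₀ := by
  simp only [Pi.smul_apply, smul_eq_mul]
  exact mul_nonneg (by positivity) hz

/-- `0 ≤ (z + e_κ)_{i₀}` for `0 ≤ z_{i₀}`. [folklore] -/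
private theorem add_e_nonneg_of {z : Site d} (hz : 0 ≤ z i₀) (κ : Fin d) : 0 ≤ (z + e κ) i₀ := by
  simp only [Pi.add_apply, e_apply]
  split_ifs <;> omega

end Geometry

/-! ## §2 «for α₀, α₂ sufficiently small»: the window `c(d, L) = cst d L / L²` -/

section Window

/-- «for α₀, α₂ sufficiently small» for the half-space family: gen 7's explicit window `B8Prop7AdmittedFamily.cst d L` (the minimum of
the windows of the inputs: (1.144) `1/(80d)`; Prop. 2 of [3] `1/(24C₀(d))`, `c₂′(d,L)/16`; Prop. 4 of [3] @gen; (162) @gen `1/(2048d)`)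
DIVIDED BY `L²`: on `Λ₀` only the level-0 thresholds of (1.139)/(1.140) are available, so the global (52)-type windows of [3] are
entered at `L²α₀`, `L²α₂`. [cite: Balaban1985RegularSpaces, Prop. 7 p.100 («for α₀, α₂ sufficiently small»)] -/
def cHS (d L : ℕ) : ℝ := cst d L / (L : ℝ) ^ 2

/-- `c(d, L) > 0` for `d, L ≥ 1`. [cite: Balaban1985RegularSpaces, Prop. 7 p.100 («for α₀, α₂ sufficiently small»)] -/
theorem cHS_pos (hd : 1 ≤ d) {L : ℕ} (hL : 1 ≤ L) : 0 < cHS d L := by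
  have : (0 : ℝ) < L := by exact_mod_cast (lt_of_lt_of_le (by norm_num) hL)
  unfold cHS
  exact div_pos (cst_pos hd L hL) (by positivity)

/-- `α ≤ c(d, L)` gives `L²α ≤ cst d L`. [folklore] -/
private theorem sq_mul_le_cst {L : ℕ} (hL : 1 ≤ L) {α : ℝ} (h : α ≤ cHS d L) : (L : ℝ) ^ 2 * α ≤ cst d L := by
  have hL0 : (0 : ℝ) < (L : ℝ) ^ 2 := by
    have : (0 : ℝ) < L := by exact_mod_cast (lt_of_lt_of_le (by norm_num) hL)
    positivity
  unfold cHS at h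
  rw [le_div_iff₀ hL0] at h
  linarith [mul_comm α ((L : ℝ) ^ 2)]

/-- What `β ≤ cst d L` gives (gen 7's `cst_facts`, which is private there). [folklore] -/
private theorem cst_facts' {L : ℕ} {β : ℝ} (hβc : β ≤ cst d L) :
    β ≤ 1 / (80 * (d : ℝ)) ∧ β ≤ 1 / (24 * C0 d) ∧ β ≤ c2' d L / 16 ∧
      β ≤ 1 / (32000 * ((d : ℝ) + 1) ^ 2 * ((d : ℝ) + 4)) ∧ β ≤ 1 / (2097152 * ((d : ℝ) + 1) ^ 2) ∧
        β ≤ c3 d L / 2 ∧ β ≤ 1 / (2048 * (d : ℝ)) := by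
  unfold cst at hβc
  simp only [le_min_iff] at hβc
  obtain ⟨h1, h2, h3, h4, h5, h6, h7⟩ := hβc
  exact ⟨h1, h2, h3, h4, h5, h6, h7⟩

end Window

/-! ## §3 The three bond classes of (1.145) ↦ (1.35) for `U′ = U₁^{u}`, `u = u8`, under the standing data of [3] @gen at `k = 1`

Standing hypotheses as in `B8Prop7AdmittedFamily` §1/§3 with `k = 1`: `U₀`, `U₁ = e^{B}` `U(𝔸)`-valued, `sup|B| ≤ b`, the Prop.-2/Prop.-4
windows of [3] @gen for `U₀` (at `α₀`) and for `U₁U₀` (at `αP`), `2048·d·Lb ≤ 1`. -/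

section Bounds

variable {𝔸 : Type*} [CStarAlgebra 𝔸] [Nontrivial 𝔸]

variable {L : ℕ} {U₀ : Site d → Fin d → 𝔸ˣ} {B : Site d → Fin d → 𝔸} {α₀ αP b : ℝ}
  (hd : 1 ≤ d) (hL : 2 ≤ L) (hU₀ : ∀ x κ, U₀ x κ ∈ unitaryUnits 𝔸) (hBu : ∀ x κ, expCfg B x κ ∈ unitaryUnits 𝔸)
  (hα : 0 < α₀) (hα3 : C0 d * α₀ ≤ 1 / 3) (hα4 : 4 * α₀ ≤ c2' d L) (h52 : pdev U₀ < α₀ * (((L : ℝ) ^ 1)⁻¹) ^ 2)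
  (hb : 0 ≤ b) (hB : ∀ x κ, ‖B x κ‖ ≤ b)
  (hsmall : Real.exp (4 * (800 * ((d : ℝ) + 1) ^ 2 * ((d : ℝ) + 4)) * α₀)
    * (1 + 8 * (131072 * ((d : ℝ) + 1) ^ 2) * ((L : ℝ) ^ 1 * b)) ≤ 2)
  (hc₃ : 2 * ((L : ℝ) ^ 1 * b) ≤ c3 d L) (hsm : 2048 * (d : ℝ) * ((L : ℝ) ^ 1 * b) ≤ 1)
  (hαP : 0 < αP) (hαP3 : C0 d * αP ≤ 1 / 3) (hαP2 : 2 * αP ≤ c2' d L)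
  (hP : pdev (expCfg B * U₀) < αP * (((L : ℝ) ^ 1)⁻¹) ^ 2)
  (hL1 : 1 ≤ L) (i₀ : Fin d)

include hd hL hU₀ hBu hα hα3 hα4 h52 hb hB hsmall hc₃ hsm hαP hαP3 hαP2 hP in
/-- **Print's `u` is `U(𝔸)`-valued**: `u8 = glev` (the gauge fixing (76)/(77)/(87) of [3], unitary by gen 7's `glev_mem_unitaryUnits`) on
`Ω₁`, `= 1` on `Λ₀`. [cite: Balaban1985RegularSpaces, (1.29) p.81 («In [3] we have determined the gauge transformation u»); Balaban1985Averaging, (76)–(77) pp.29–30, (87) p.31] -/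
theorem u8_mem_unitaryUnits (x : Site d) : u8 L hL1 i₀ U₀ (expCfg B) x ∈ unitaryUnits 𝔸 := by
  unfold u8
  split_ifs
  · exact glev_mem_unitaryUnits hd hL hU₀ hBu hα hα3 hα4 h52 hb hB hsmall hc₃ hsm hαP hαP3 hαP2 hP hL1 0 (Nat.zero_le _) x
  · exact (unitaryUnits 𝔸).one_mem

include hd hL hU₀ hBu hα hα3 hα4 h52 hb hB hsmall hc₃ hsm hαP hαP3 hαP2 hP in
/-- **`|u(x) − 1| ≤ 200dLb` at every site**: on `Ω₁` gen 7's telescoped bound `norm_glev_sub_one_le` (the recursion (76)/(77) from the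
top value (87)), on `Λ₀` `u = 1`. [cite: Balaban1985RegularSpaces, (1.29) p.81; Balaban1985Averaging, (76)–(77) pp.29–30, (87) p.31, (163) p.42] -/
theorem norm_u8_sub_one_le (x : Site d) :
    ‖((u8 L hL1 i₀ U₀ (expCfg B) x : 𝔸ˣ) : 𝔸) - 1‖ ≤ 200 * (d : ℝ) * ((L : ℝ) ^ 1 * b) := by
  unfold u8
  split_ifs
  · exact norm_glev_sub_one_le hd hL hU₀ hBu hα hα3 hα4 h52 hb hB hsmall hc₃ hsm hαP hαP3 hαP2 hP hL1 0 (Nat.zero_le _) x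
  · rw [Units.val_one, sub_self, norm_zero]; positivity

include hd hL hb hsm in
/-- Level arithmetic: `b ≤ 1/5`, `0 ≤ Lb`. [folklore] -/
private theorem b_small : b ≤ 1 / 5 ∧ 0 ≤ (L : ℝ) ^ 1 * b ∧ b ≤ (L : ℝ) ^ 1 * b := by
  have hL1 : (1 : ℝ) ≤ L := by exact_mod_cast le_trans (by norm_num) hL
  have hd1 : (1 : ℝ) ≤ d := by exact_mod_cast hd
  have hLb : 0 ≤ (L : ℝ) ^ 1 * b := by positivity
  have hbLb : b ≤ (L : ℝ) ^ 1 * b := by rw [pow_one]; nlinarith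
  refine ⟨?_, hLb, hbLb⟩
  nlinarith

include hd hL hU₀ hBu hα hα3 hα4 h52 hb hB hsmall hc₃ hsm hαP hαP3 hαP2 hP in
/-- **(1.145) ↦ (1.35) AT LEVEL 0, the bonds «on Λ₀»** (`b₋ = x ∈ Λ₀`, so `u(b₋) = 1` by (1.14)/(1.29)₀): `(U′U₀)_b − U₀,b =
(U₁,b·R(U₀,b)u(b₊)⁻¹ − 1)·U₀,b` ((1.17)), hence `|(U′U₀)_b − U₀,b| ≤ |U₁,b − 1| + |u(b₊) − 1| ≤ b + 200dLb` ((24) for `U₁,b = e^{B_b}`;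
`u(b₊) ∈ {1, glev(b₊)}`). [cite: Balaban1985RegularSpaces, (1.145) p.100, (1.35) p.82, (1.17) p.78, (1.14) p.78; Balaban1985Averaging, (24) p.21, (55) p.27] -/
theorem norm_avgIter_u8_sub_le_zero {x : Site d} (hx : x i₀ < 0) (κ : Fin d) :
    ‖((avgIter L (mgauge U₀ (u8 L hL1 i₀ U₀ (expCfg B)) (expCfg B) * U₀) 0 x κ : 𝔸ˣ) : 𝔸)
        - ((avgIter L U₀ 0 x κ : 𝔸ˣ) : 𝔸)‖ ≤ b + 200 * (d : ℝ) * ((L : ℝ) ^ 1 * b) := by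
  obtain ⟨hb5, -, -⟩ := b_small hd hL hb hsm
  set g : 𝔸ˣ := u8 L hL1 i₀ U₀ (expCfg B) (x + e κ) with hg
  have hgu : g ∈ unitaryUnits 𝔸 := u8_mem_unitaryUnits hd hL hU₀ hBu hα hα3 hα4 h52 hb hB hsmall hc₃ hsm hαP hαP3 hαP2 hP hL1 i₀ _
  -- (1.17) at the bond, with `u(b₋) = 1`
  have e1 : avgIter L (mgauge U₀ (u8 L hL1 i₀ U₀ (expCfg B)) (expCfg B) * U₀) 0 x κ
      = (expCfg B x κ * Rc (U₀ x κ) g⁻¹) * U₀ x κ := by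
    simp only [avgIter_zero, Pi.mul_apply, mgauge_apply]
    rw [u8_of_neg L hL1 i₀ U₀ (expCfg B) hx, one_mul, map_inv]
  rw [e1, avgIter_zero, Units.val_mul]
  have key : (((expCfg B x κ * Rc (U₀ x κ) g⁻¹ : 𝔸ˣ) : 𝔸)) * ((U₀ x κ : 𝔸ˣ) : 𝔸) - ((U₀ x κ : 𝔸ˣ) : 𝔸)
      = ((((expCfg B x κ * Rc (U₀ x κ) g⁻¹ : 𝔸ˣ) : 𝔸)) - 1) * ((U₀ x κ : 𝔸ˣ) : 𝔸) := by
    noncomm_ring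
  rw [key]
  have hY : ‖((U₀ x κ : 𝔸ˣ) : 𝔸)‖ ≤ 1 := (unitaryUnits_le_U1 (hU₀ x κ)).1
  -- `|U₁,b − 1| ≤ |B_b| ≤ b` ((24)) and `|R(U₀,b)u(b₊)⁻¹ − 1| ≤ |u(b₊) − 1| ≤ 200dLb`
  have h1 : ‖((expCfg B x κ : 𝔸ˣ) : 𝔸) - 1‖ ≤ b := by
    have hmem : exp (B x κ) ∈ unitary 𝔸 := (mem_unitaryUnits).1 (hBu x κ)
    exact (norm_exp_sub_one_le_of_mem_unitary hmem ((hB x κ).trans hb5)).trans (hB x κ)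
  have h2 : ‖((Rc (U₀ x κ) g⁻¹ : 𝔸ˣ) : 𝔸) - 1‖ ≤ 200 * (d : ℝ) * ((L : ℝ) ^ 1 * b) := by
    rw [Rc_apply, Units.val_mul, Units.val_mul]
    refine (norm_units_conj_sub_one_le (unitaryUnits_le_U1 (hU₀ x κ)) _).trans ?_
    refine (norm_inv_sub_one_le (unitaryUnits_le_U1 hgu)).trans ?_
    rw [hg]
    exact norm_u8_sub_one_le hd hL hU₀ hBu hα hα3 hα4 h52 hb hB hsmall hc₃ hsm hαP hαP3 hαP2 hP hL1 i₀ _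
  have h12 := norm_units_mul_sub_one_le (q := Rc (U₀ x κ) g⁻¹) (unitaryUnits_le_U1 (hBu x κ))
  calc _ ≤ ‖(((expCfg B x κ * Rc (U₀ x κ) g⁻¹ : 𝔸ˣ) : 𝔸)) - 1‖ * ‖((U₀ x κ : 𝔸ˣ) : 𝔸)‖ := norm_mul_le _ _
    _ ≤ (b + 200 * (d : ℝ) * ((L : ℝ) ^ 1 * b)) * 1 :=
        mul_le_mul (h12.trans (by linarith)) hY (norm_nonneg _) (by positivity)
    _ = _ := mul_one _

omit [Nontrivial 𝔸] in
/-- **(87) of [3] at the two ends of an INTERIOR level-1 bond for `u8`** (`0 ≤ z_{i₀}`): `u(L•z) = glev(L•z) = w₁(z)⁻¹` — the definition of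
`u8` on `Ω₁`, `glev_centre`/`glev_top`. [cite: Balaban1985Averaging, (87) p.31, (76)–(77) pp.29–30; Balaban1985RegularSpaces, (1.29) p.81] -/
theorem uLev_u8_one (U₁ : Site d → Fin d → 𝔸ˣ) {z : Site d} (hz : 0 ≤ z i₀) :
    uLev L (u8 L hL1 i₀ U₀ U₁) 1 z = (wrec L U₀ U₁ 1 z)⁻¹ := by
  have e1 : uLev L (u8 L hL1 i₀ U₀ U₁) 1 z = u8 L hL1 i₀ U₀ U₁ ((L : ℤ) • z) := by
    simp [uLev]
  rw [e1]
  unfold u8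
  rw [if_pos (smul_nonneg_of L i₀ hz)]
  exact (glev_centre L hL1 U₀ U₁ Nat.zero_lt_one z).trans (glev_top L hL1 U₀ U₁ 1 z)

include hd hL hU₀ hBu hα hα3 hα4 h52 hb hB hsmall hc₃ hsm hαP hαP3 hαP2 hP in
/-- **(1.145) ↦ (1.35) AT LEVEL 1, INTERIOR BONDS** (`b₋, b₊ ∈ Λ₁`): p. 81 *"If both end-points b₋, b₊ of a bond b belong to Λ_j, then the
expression on the left-hand side of (1.30) is equal to (Ū₁ʲ)_b by (92) of [3]"* — `Ũ′¹_b = (U̿₁¹)_b` (`B8Eq131Derivation.eq130_interior`,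
the (87)-values of `u8` at both ends), so `(U′U₀)‾¹_b − (Ū₀¹)_b = ((U̿₁¹)_b − 1)(Ū₀¹)_b` with `|(U̿₁¹)_b − 1| ≤ |Q₁| ≤ 2Lb` ((161)/(1.143)
with (24), gen 7's `norm_dbavgCovIter_sub_one_le`). [cite: Balaban1985RegularSpaces, (1.145) p.100, (1.30)–(1.31) pp.81–82, (1.143) p.100; Balaban1985Averaging, (92) p.31, (161) p.42, (24) p.21] -/
theorem norm_avgIter_u8_sub_le_interior {z : Site d} (hz : 0 ≤ z i₀) (κ : Fin d) :
    ‖((avgIter L (mgauge U₀ (u8 L hL1 i₀ U₀ (expCfg B)) (expCfg B) * U₀) 1 z κ : 𝔸ˣ) : 𝔸)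
        - ((avgIter L U₀ 1 z κ : 𝔸ˣ) : 𝔸)‖ ≤ 2 * ((L : ℝ) ^ 1 * b) := by
  have h130 : tildIter L U₀ (mgauge U₀ (u8 L hL1 i₀ U₀ (expCfg B)) (expCfg B)) 1 z κ = dbavgCovIter L U₀ (expCfg B) 1 z κ :=
    eq130_interior L U₀ (expCfg B) _ 1 z κ (uLev_u8_one hL1 i₀ (expCfg B) hz)
      (uLev_u8_one hL1 i₀ (expCfg B) (add_e_nonneg_of i₀ hz κ))
  have e : avgIter L (mgauge U₀ (u8 L hL1 i₀ U₀ (expCfg B)) (expCfg B) * U₀) 1 z κ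
      = tildIter L U₀ (mgauge U₀ (u8 L hL1 i₀ U₀ (expCfg B)) (expCfg B)) 1 z κ * avgIter L U₀ 1 z κ := by
    rw [← tildIter_mul]; rfl
  rw [e, h130, Units.val_mul]
  have hY : ‖((avgIter L U₀ 1 z κ : 𝔸ˣ) : 𝔸)‖ ≤ 1 :=
    (unitaryUnits_le_U1 (avgIter_mem_unitaryUnits hL hU₀ hα hα3 hα4 h52 1 le_rfl z κ)).1
  have hX := norm_dbavgCovIter_sub_one_le hd hL hU₀ hBu hα hα3 hα4 h52 hb hB hsmall hc₃ hsm hαP hαP3 hαP2 hP (le_refl 1) z κ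
  have key : ((dbavgCovIter L U₀ (expCfg B) 1 z κ : 𝔸ˣ) : 𝔸) * ((avgIter L U₀ 1 z κ : 𝔸ˣ) : 𝔸)
      - ((avgIter L U₀ 1 z κ : 𝔸ˣ) : 𝔸)
        = (((dbavgCovIter L U₀ (expCfg B) 1 z κ : 𝔸ˣ) : 𝔸) - 1) * ((avgIter L U₀ 1 z κ : 𝔸ˣ) : 𝔸) := by
    noncomm_ring
  rw [key]
  have hLb : 0 ≤ (L : ℝ) ^ 1 * b := by positivity
  calc _ ≤ ‖((dbavgCovIter L U₀ (expCfg B) 1 z κ : 𝔸ˣ) : 𝔸) - 1‖ * ‖((avgIter L U₀ 1 z κ : 𝔸ˣ) : 𝔸)‖ := norm_mul_le _ _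
    _ ≤ 2 * ((L : ℝ) ^ 1 * b) * 1 := mul_le_mul hX hY (norm_nonneg _) (by positivity)
    _ = _ := mul_one _

omit [Nontrivial 𝔸] in
/-- The block frame (82) of `U₁` at `U₀` IS `v₁` of (97) (`v₁(z) = v₀(Lz)·\overline{R_{0,Lz}U₁} = \overline{R_{0,Lz}U₁}`).
[cite: Balaban1985Averaging, (97) p.32, (82) p.30] -/
theorem wframe_eq_vcov_one (U₁ : Site d → Fin d → 𝔸ˣ) (z : Site d) :
    wframe L U₀ U₁ ((L : ℤ) • z) = vcov L U₀ U₁ 1 z := by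
  rw [vcov_succ, vcov_zero, one_mul]; rfl

include hd hL hU₀ hBu hα hα3 hα4 h52 hb hB hsmall hc₃ hsm hαP hαP3 hαP2 hP in
/-- **(1.145) ↦ (1.35) AT LEVEL 1, CROSSING BONDS** (`b = ⟨z, z + e_{i₀}⟩`, `z_{i₀} = −1`: `b₊ ∈ Λ₁`, `B(b₋) ⊂ Λ₀`): p. 81 *"the formulas
(97), (99), and (87) of [3] imply (Ũ₁^{u j})_b = \overline{R̄^{j−1}_{0,b₋}Ū₁^{j−1}}(Ū₁ʲ)_b"* — `Ũ′¹_b = \overline{R_{0,b₋}U₁}·(U̿₁¹)_b` (r05 g6's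
`tildIter_u8_crossing`), the frame being `v₁(b₋)` ((97)), unitary and within `64dLb` of `1` ((163) @gen, gen 7's `norm_vcov_sub_one_le`),
`(U̿₁¹)_b` within `2Lb`: `|(U′U₀)‾¹_b − (Ū₀¹)_b| ≤ 64dLb + 2Lb` — THE located constant of G-B8-01 (print: `< 2α₂`, refuted §5).
[cite: Balaban1985RegularSpaces, (1.145) p.100, (1.30)–(1.31) pp.81–82; Balaban1985Averaging, (97) p.32, (82) p.30, (163) p.42, (161) p.42] -/
theorem norm_avgIter_u8_sub_le_crossing {z : Site d} (hz : z i₀ = -1) :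
    ‖((avgIter L (mgauge U₀ (u8 L hL1 i₀ U₀ (expCfg B)) (expCfg B) * U₀) 1 z i₀ : 𝔸ˣ) : 𝔸)
        - ((avgIter L U₀ 1 z i₀ : 𝔸ˣ) : 𝔸)‖ ≤ 64 * (d : ℝ) * ((L : ℝ) ^ 1 * b) + 2 * ((L : ℝ) ^ 1 * b) := by
  have h130 := tildIter_u8_crossing L hL1 i₀ U₀ (expCfg B) z hz
  rw [wframe_eq_vcov_one] at h130
  have e : avgIter L (mgauge U₀ (u8 L hL1 i₀ U₀ (expCfg B)) (expCfg B) * U₀) 1 z i₀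
      = tildIter L U₀ (mgauge U₀ (u8 L hL1 i₀ U₀ (expCfg B)) (expCfg B)) 1 z i₀ * avgIter L U₀ 1 z i₀ := by
    rw [← tildIter_mul]; rfl
  rw [e, h130, Units.val_mul]
  obtain ⟨hW, hv⟩ := dbavgCovIter_vcov_mem_unitaryUnits hd hL hU₀ hBu hα hα3 hα4 h52 hb hB hsmall hc₃ hsm hαP hαP3 hαP2 hP 1 le_rfl
  have hY : ‖((avgIter L U₀ 1 z i₀ : 𝔸ˣ) : 𝔸)‖ ≤ 1 :=
    (unitaryUnits_le_U1 (avgIter_mem_unitaryUnits hL hU₀ hα hα3 hα4 h52 1 le_rfl z i₀)).1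
  have h1 := (norm_vcov_sub_one_le hL hU₀ hα hα3 hα4 h52 hb hB hsmall hc₃ hsm (le_refl 1) z).1
  have h2 := norm_dbavgCovIter_sub_one_le hd hL hU₀ hBu hα hα3 hα4 h52 hb hB hsmall hc₃ hsm hαP hαP3 hαP2 hP (le_refl 1) z i₀
  have h12 := (norm_units_mul_sub_one_le (q := dbavgCovIter L U₀ (expCfg B) 1 z i₀) (unitaryUnits_le_U1 (hv z))).trans
    (add_le_add h1 h2)
  have key : ((vcov L U₀ (expCfg B) 1 z * dbavgCovIter L U₀ (expCfg B) 1 z i₀ : 𝔸ˣ) : 𝔸) * ((avgIter L U₀ 1 z i₀ : 𝔸ˣ) : 𝔸)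
      - ((avgIter L U₀ 1 z i₀ : 𝔸ˣ) : 𝔸)
        = (((vcov L U₀ (expCfg B) 1 z * dbavgCovIter L U₀ (expCfg B) 1 z i₀ : 𝔸ˣ) : 𝔸) - 1)
          * ((avgIter L U₀ 1 z i₀ : 𝔸ˣ) : 𝔸) := by
    noncomm_ring
  rw [key]
  have hLb : 0 ≤ (L : ℝ) ^ 1 * b := by positivity
  calc _ ≤ ‖((vcov L U₀ (expCfg B) 1 z * dbavgCovIter L U₀ (expCfg B) 1 z i₀ : 𝔸ˣ) : 𝔸) - 1‖
          * ‖((avgIter L U₀ 1 z i₀ : 𝔸ˣ) : 𝔸)‖ := norm_mul_le _ _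
    _ ≤ (64 * (d : ℝ) * ((L : ℝ) ^ 1 * b) + 2 * ((L : ℝ) ^ 1 * b)) * 1 :=
        mul_le_mul h12 hY (norm_nonneg _) (by positivity)
    _ = _ := mul_one _

include hd hL hU₀ hBu hα hα3 hα4 h52 hb hB hsmall hc₃ hsm hαP hαP3 hαP2 hP in
/-- **(1.145) ↦ (1.35) «on Λ_j», `j = 0, 1`, ALL BONDS, one constant**: `|(U′U₀)‾ʲ_b − (Ū₀ʲ)_b| ≤ 201dLb` on every bond of `Λ_j`
(bond convention p. 77), combining the three classes (`b ≤ Lb ≤ dLb`, `d ≥ 1`, `L ≥ 2`).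
[cite: Balaban1985RegularSpaces, (1.145) p.100, (1.35) p.82, (1.31) p.82] -/
theorem norm_avgIter_u8_sub_le {j : ℕ} (hj : j ≤ 1) {z : Site d} {κ : Fin d} (hb' : BondTouches (Lam i₀ j) z κ) :
    ‖((avgIter L (mgauge U₀ (u8 L hL1 i₀ U₀ (expCfg B)) (expCfg B) * U₀) j z κ : 𝔸ˣ) : 𝔸)
        - ((avgIter L U₀ j z κ : 𝔸ˣ) : 𝔸)‖ ≤ 201 * (d : ℝ) * ((L : ℝ) ^ 1 * b) := by
  obtain ⟨-, hLb, hbLb⟩ := b_small hd hL hb hsm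
  have hd1 : (1 : ℝ) ≤ d := by exact_mod_cast hd
  have hdLb : (L : ℝ) ^ 1 * b ≤ (d : ℝ) * ((L : ℝ) ^ 1 * b) := by nlinarith
  interval_cases j
  · have h := norm_avgIter_u8_sub_le_zero hd hL hU₀ hBu hα hα3 hα4 h52 hb hB hsmall hc₃ hsm hαP hαP3 hαP2 hP hL1 i₀
      (bondTouches_lam_zero hb') κ
    nlinarith
  · rcases bondTouches_lam_one hb' with hz | ⟨hz, hκ⟩
    · have h := norm_avgIter_u8_sub_le_interior hd hL hU₀ hBu hα hα3 hα4 h52 hb hB hsmall hc₃ hsm hαP hαP3 hαP2 hP hL1 i₀ hz κ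
      nlinarith
    · rw [hκ]
      have h := norm_avgIter_u8_sub_le_crossing hd hL hU₀ hBu hα hα3 hα4 h52 hb hB hsmall hc₃ hsm hαP hαP3 hαP2 hP hL1 i₀ hz
      nlinarith

end Bounds

/-! ## §4 The half-space family packaged as `B8SectGH.GFData3`, and Proposition 7 (repaired) for it -/

section Model

open Complex (I)

variable {𝔸 : Type} [CStarAlgebra 𝔸] [Nontrivial 𝔸]

/-- `Real.exp (1/5) · (3/2) ≤ 2`. [folklore] -/
private theorem exp_fifth_mul_le' : Real.exp (1 / 5) * (1 + 1 / 2) ≤ 2 := by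
  have := B7Eq31BCH.exp_one_fifth_le
  nlinarith [Real.exp_pos (1 / 5 : ℝ)]

omit [Nontrivial 𝔸] in
/-- A second direction exists for `d ≥ 2`; used to read the level-0 member of (1.140) on every bond. [folklore] -/
private theorem norm_A_le_of_cond140_zero (hd : 2 ≤ d) (i₀ : Fin d) {L : ℕ} {η α₂ : ℝ}
    {U₀ : Site d → Fin d → 𝔸ˣ} {A : Site d → Fin d → 𝔸} (h140 : Cond140 L η α₂ 0 (OmegaHS i₀ 0) U₀ A) (y : Site d) (τ : Fin d) :
    ‖A y τ‖ ≤ α₂ * η⁻¹ := by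
  have h := (h140.1 y τ (sideTouches_omegaHS_zero hd i₀ y τ)).le
  simpa using h

/-- THE STANDING DATA of §3 produced from the hypotheses of Proposition 7 for the half-space family (`k = 1`): `B = iηA` with
`sup|B| ≤ b = α₂` (the LEVEL-0 member of (1.140), valid on every bond), `U₁ = e^{iηA}` unitary-valued, the Prop.-2/Prop.-4 windows of
[3] @gen for `U₀` at `α₀′ = 2L²α₀` (the LEVEL-0 clause of (1.139) summed up, `B8Ineq1144TwistedAxial.pdev_le_of_forall`) and for
`U₁U₀` at `αP = 2L²(α₀ + 3α₂)` (the level-0 clause of p40 g5's `B8Prop7ClassAkLocal.inAk_mulCfg_hermitian_loc` summed up), all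
from `0 < α₀, α₂ ≤ c(d, L) = cst d L / L²`. [cite: Balaban1985RegularSpaces, (1.139)–(1.141) p.100; Balaban1985Averaging, (52) p.26] -/
private theorem standingHS (hd : 2 ≤ d) {L : ℕ} (hL : 2 ≤ L) (hL1 : 1 ≤ L) (i₀ : Fin d) {η : ℝ} (hη : 0 < η)
    {α₀ α₂ : ℝ} (hα₀ : 0 < α₀) (hα₀c : α₀ ≤ cHS d L) (hα₂ : 0 < α₂) (hα₂c : α₂ ≤ cHS d L)
    {U₀ : Site d → Fin d → 𝔸ˣ} (hU₀ : ∀ x κ, U₀ x κ ∈ unitaryUnits 𝔸) (h139 : InAk L 1 η α₀ (OmegaHS i₀) U₀)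
    {A : Site d → Fin d → 𝔸} (hAh : ∀ y κ, IsSelfAdjoint (A y κ))
    (h140 : ∀ j, j ≤ 1 → Cond140 L η α₂ j (OmegaHS i₀ j) U₀ A) :
    0 ≤ α₂ ∧ (∀ x κ, ‖iEta η A x κ‖ ≤ α₂) ∧ (∀ x κ, expCfg (iEta η A) x κ ∈ unitaryUnits 𝔸) ∧
    0 < 2 * (L : ℝ) ^ 2 * α₀ ∧ C0 d * (2 * (L : ℝ) ^ 2 * α₀) ≤ 1 / 3 ∧ 4 * (2 * (L : ℝ) ^ 2 * α₀) ≤ c2' d L ∧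
    pdev U₀ < 2 * (L : ℝ) ^ 2 * α₀ * (((L : ℝ) ^ 1)⁻¹) ^ 2 ∧
    Real.exp (4 * (800 * ((d : ℝ) + 1) ^ 2 * ((d : ℝ) + 4)) * (2 * (L : ℝ) ^ 2 * α₀))
      * (1 + 8 * (131072 * ((d : ℝ) + 1) ^ 2) * ((L : ℝ) ^ 1 * α₂)) ≤ 2 ∧
    2 * ((L : ℝ) ^ 1 * α₂) ≤ c3 d L ∧ 2048 * (d : ℝ) * ((L : ℝ) ^ 1 * α₂) ≤ 1 ∧
    0 < 2 * (L : ℝ) ^ 2 * (α₀ + 3 * α₂) ∧ C0 d * (2 * (L : ℝ) ^ 2 * (α₀ + 3 * α₂)) ≤ 1 / 3 ∧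
    2 * (2 * (L : ℝ) ^ 2 * (α₀ + 3 * α₂)) ≤ c2' d L ∧
    pdev (expCfg (iEta η A) * U₀) < 2 * (L : ℝ) ^ 2 * (α₀ + 3 * α₂) * (((L : ℝ) ^ 1)⁻¹) ^ 2 ∧
    α₀ ≤ 1 / (80 * (d : ℝ)) ∧ α₂ ≤ 1 / (80 * (d : ℝ)) := by
  have hd1 : 1 ≤ d := le_trans (by norm_num) hd
  -- the windows, at `L²α₀`, `L²α₂`
  have hsq₀ := sq_mul_le_cst hL1 hα₀c
  have hsq₂ := sq_mul_le_cst hL1 hα₂c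
  obtain ⟨h80₀, h24₀, hc2₀, h32₀, -, -, -⟩ := cst_facts' hsq₀
  obtain ⟨h80₂, h24₂, hc2₂, -, h21₂, hc3₂, h2048₂⟩ := cst_facts' hsq₂
  have hd' : (1 : ℝ) ≤ d := by exact_mod_cast hd1
  have hC0 := C0_pos d
  have hc2 : 0 < c2' d L := by unfold c2'; positivity
  have hLr : (2 : ℝ) ≤ L := by exact_mod_cast hL
  have hL1' : (1 : ℝ) ≤ L := by linarith
  have hL0 : (0 : ℝ) < L := by linarith
  have hη0 : η ≠ 0 := hη.ne'
  have hL2 : (1 : ℝ) ≤ (L : ℝ) ^ 2 := one_le_pow₀ hL1'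
  -- `α ≤ L²α` and `Lα ≤ L²α`
  have hα₀L : α₀ ≤ (L : ℝ) ^ 2 * α₀ := le_mul_of_one_le_left hα₀.le hL2
  have hα₂L : α₂ ≤ (L : ℝ) ^ 2 * α₂ := le_mul_of_one_le_left hα₂.le hL2
  have hLα₂ : (L : ℝ) ^ 1 * α₂ ≤ (L : ℝ) ^ 2 * α₂ :=
    mul_le_mul_of_nonneg_right (pow_le_pow_right₀ hL1' (by norm_num)) hα₂.le
  -- `b = α₂`: the level-0 member of (1.140) on every bond
  have hA0 : ∀ y τ, ‖A y τ‖ ≤ α₂ * η⁻¹ := norm_A_le_of_cond140_zero hd i₀ (h140 0 (Nat.zero_le _))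
  have hBn : ∀ x κ, ‖iEta η A x κ‖ ≤ α₂ := fun x κ =>
    (norm_iEta_le hη.le hA0 x κ).trans_eq (by field_simp)
  have hBu : ∀ x κ, expCfg (iEta η A) x κ ∈ unitaryUnits 𝔸 := expCfg_iEta_mem_unitaryUnits η hAh
  have h₀ : ∀ y κ, U₀ y κ ∈ U1 𝔸 := fun y κ => unitaryUnits_le_U1 (hU₀ y κ)
  -- (52) for `U₀` at `2L²α₀`: the level-0 clause of (1.139) on every plaquette
  have h7 : ∀ (y : Site d) (κ ν : Fin d), κ ≠ ν → ‖plaqF U₀ κ ν y - 1‖ ≤ α₀ := fun y κ ν hκν => by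
    have h := ((h139 0 (Nat.zero_le _)).1 y κ ν hκν (plaqTouches_omegaHS_zero i₀ y κ ν)).le
    simpa using h
  have h52 : pdev U₀ < 2 * (L : ℝ) ^ 2 * α₀ * (((L : ℝ) ^ 1)⁻¹) ^ 2 := by
    have hle : pdev U₀ ≤ α₀ := pdev_le_of_forall hα₀.le h7
    have : 2 * (L : ℝ) ^ 2 * α₀ * (((L : ℝ) ^ 1)⁻¹) ^ 2 = 2 * α₀ := by field_simp
    rw [this]; linarith
  -- (52) for `U₁U₀` at `2L²(α₀ + 3α₂)`: the level-0 clause of p40's (1.144) `𝔄_k`-conclusion on every plaquette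
  have hAk := inAk_mulCfg_hermitian_loc hη hL1 (k := 1) h₀ hAh hα₀.le (hα₀L.trans h80₀) hα₂.le (hα₂L.trans h80₂) h139 h140
  have hP : pdev (expCfg (iEta η A) * U₀) < 2 * (L : ℝ) ^ 2 * (α₀ + 3 * α₂) * (((L : ℝ) ^ 1)⁻¹) ^ 2 := by
    have h7' : ∀ (y : Site d) (κ ν : Fin d), κ ≠ ν →
        ‖plaqF (mulCfg (B8Eq146AExpansion.expCfg (iEta η A)) U₀) κ ν y - 1‖ ≤ α₀ + 3 * α₂ :=
      fun y κ ν hκν => by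
      have h := ((hAk 0 (Nat.zero_le _)).1 y κ ν hκν (plaqTouches_omegaHS_zero i₀ y κ ν)).le
      simpa using h
    have hle : pdev (mulCfg (B8Eq146AExpansion.expCfg (iEta η A)) U₀) ≤ α₀ + 3 * α₂ :=
      pdev_le_of_forall (by positivity) h7'
    have hmul : mulCfg (B8Eq146AExpansion.expCfg (iEta η A)) U₀ = expCfg (iEta η A) * U₀ := rfl
    rw [hmul] at hle
    have : 2 * (L : ℝ) ^ 2 * (α₀ + 3 * α₂) * (((L : ℝ) ^ 1)⁻¹) ^ 2 = 2 * (α₀ + 3 * α₂) := by field_simp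
    rw [this]; linarith
  -- the Prop.-2 / Prop.-4 windows
  have e24 : C0 d * (1 / (24 * C0 d)) = 1 / 24 := by field_simp
  have hC₀ : C0 d * ((L : ℝ) ^ 2 * α₀) ≤ 1 / 24 := (mul_le_mul_of_nonneg_left h24₀ hC0.le).trans_eq e24
  have hC₂ : C0 d * ((L : ℝ) ^ 2 * α₂) ≤ 1 / 24 := (mul_le_mul_of_nonneg_left h24₂ hC0.le).trans_eq e24
  have hsmall : Real.exp (4 * (800 * ((d : ℝ) + 1) ^ 2 * ((d : ℝ) + 4)) * (2 * (L : ℝ) ^ 2 * α₀))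
      * (1 + 8 * (131072 * ((d : ℝ) + 1) ^ 2) * ((L : ℝ) ^ 1 * α₂)) ≤ 2 := by
    have e5 : (6400 * (((d : ℝ) + 1) ^ 2 * ((d : ℝ) + 4))) * (1 / (32000 * ((d : ℝ) + 1) ^ 2 * ((d : ℝ) + 4)))
        = 1 / 5 := by
      field_simp; ring
    have hx : 4 * (800 * ((d : ℝ) + 1) ^ 2 * ((d : ℝ) + 4)) * (2 * (L : ℝ) ^ 2 * α₀) ≤ 1 / 5 := by
      have h := (mul_le_mul_of_nonneg_left h32₀ (by positivity :
        (0 : ℝ) ≤ 6400 * (((d : ℝ) + 1) ^ 2 * ((d : ℝ) + 4)))).trans_eq e5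
      have : 4 * (800 * ((d : ℝ) + 1) ^ 2 * ((d : ℝ) + 4)) * (2 * (L : ℝ) ^ 2 * α₀)
          = (6400 * (((d : ℝ) + 1) ^ 2 * ((d : ℝ) + 4))) * ((L : ℝ) ^ 2 * α₀) := by ring
      rw [this]; exact h
    have e2 : (1048576 * ((d : ℝ) + 1) ^ 2) * (1 / (2097152 * ((d : ℝ) + 1) ^ 2)) = 1 / 2 := by
      field_simp; ring
    have hy : 8 * (131072 * ((d : ℝ) + 1) ^ 2) * ((L : ℝ) ^ 1 * α₂) ≤ 1 / 2 := by
      have h := (mul_le_mul_of_nonneg_left (hLα₂.trans h21₂) (by positivity :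
        (0 : ℝ) ≤ 1048576 * ((d : ℝ) + 1) ^ 2)).trans_eq e2
      have : 8 * (131072 * ((d : ℝ) + 1) ^ 2) * ((L : ℝ) ^ 1 * α₂) = (1048576 * ((d : ℝ) + 1) ^ 2) * ((L : ℝ) ^ 1 * α₂) := by
        ring
      rw [this]; exact h
    have hy0 : 0 ≤ 8 * (131072 * ((d : ℝ) + 1) ^ 2) * ((L : ℝ) ^ 1 * α₂) := by positivity
    calc _ ≤ Real.exp (1 / 5) * (1 + 1 / 2) := by gcongr
      _ ≤ 2 := exp_fifth_mul_le'
  have hc₃ : 2 * ((L : ℝ) ^ 1 * α₂) ≤ c3 d L := by linarith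
  have hsm : 2048 * (d : ℝ) * ((L : ℝ) ^ 1 * α₂) ≤ 1 := by
    have hd0 : (0 : ℝ) < d := by linarith
    have e1 : (2048 * (d : ℝ)) * (1 / (2048 * (d : ℝ))) = 1 := by field_simp
    exact (mul_le_mul_of_nonneg_left (hLα₂.trans h2048₂) (by positivity : (0 : ℝ) ≤ 2048 * (d : ℝ))).trans_eq e1
  -- the (52)-windows at `2L²α₀` and `2L²(α₀ + 3α₂)`
  have hw1 : C0 d * (2 * (L : ℝ) ^ 2 * α₀) ≤ 1 / 3 := by
    have : C0 d * (2 * (L : ℝ) ^ 2 * α₀) = 2 * (C0 d * ((L : ℝ) ^ 2 * α₀)) := by ring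
    rw [this]; linarith
  have hw2 : 4 * (2 * (L : ℝ) ^ 2 * α₀) ≤ c2' d L := by
    have : 4 * (2 * (L : ℝ) ^ 2 * α₀) = 8 * ((L : ℝ) ^ 2 * α₀) := by ring
    rw [this]; linarith
  have hw3 : C0 d * (2 * (L : ℝ) ^ 2 * (α₀ + 3 * α₂)) ≤ 1 / 3 := by
    have : C0 d * (2 * (L : ℝ) ^ 2 * (α₀ + 3 * α₂))
        = 2 * (C0 d * ((L : ℝ) ^ 2 * α₀)) + 6 * (C0 d * ((L : ℝ) ^ 2 * α₂)) := by ring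
    rw [this]; linarith
  have hw4 : 2 * (2 * (L : ℝ) ^ 2 * (α₀ + 3 * α₂)) ≤ c2' d L := by
    have : 2 * (2 * (L : ℝ) ^ 2 * (α₀ + 3 * α₂)) = 4 * ((L : ℝ) ^ 2 * α₀) + 12 * ((L : ℝ) ^ 2 * α₂) := by ring
    rw [this]; linarith
  have hp1 : 0 < 2 * (L : ℝ) ^ 2 * α₀ := by positivity
  have hp2 : 0 < 2 * (L : ℝ) ^ 2 * (α₀ + 3 * α₂) := by positivity
  exact ⟨hα₂.le, hBn, hBu, hp1, hw1, hw2, h52, hsmall, hc₃, hsm, hp2, hw3, hw4, hP, hα₀L.trans h80₀, hα₂L.trans h80₂⟩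

variable (d) in
/-- **The half-space family for Proposition 7, packaged as pv17's `B8SectGH.GFData3`** — index `η > 0` (the lattice spacing) for fixed
dimension `d`, block size `L`, normal direction `i₀` and C⋆-algebra `𝔸` (print: `M_N(ℂ) ⊃ U(N) ⊃ G`; here `G = U(𝔸)`): `k = 1`, the
admissible sequence `Ω₀ = T_η ⊃ Ω₁ = {x : 0 ≤ x_{i₀}}` (`OmegaHS`) with sets (1.5) `Λ₁ = {z : 0 ≤ z_{i₀}}`, `Λ₀ = {x : x_{i₀} < 0}`
(`B8Ineq145Lineage.Lam`), `𝔅₁ = Λ₀ ∪ Λ₁`.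
* `Cfg` = `U(𝔸)`-valued configurations on `T_η ↦ ℤᵈ`; `Pert` = configurations `U₁`/`U′`; `GT` = gauge transformations; `Src = Unit`.
* `InA α U₀` = (1.139)/(1.33) «U₀ ∈ 𝔄_1({Ω_j}, α)» = `B8Ineq132.InAk` over `OmegaHS` (LEVEL-WISE thresholds, p. 77);
  `C140 α₂ U₀ U₁` = «U₁ = e^{iηA}», `A` Hermitian, with (1.140) «on Ω_j», `j = 0, 1`, ALL THREE members, in p40 g5's located reading
  `B8Eq140Level.Cond140 L η α₂ j (Ω_j) U₀ A`; `InAAx α U₀ U′` = (1.144)/(1.34) «U′U₀ ∈ 𝔄_1({Ω_j}, α) ∩ Ax_1(𝔅_1, U₀)» (`InAk ∧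
  B8Eq119TwistedAxial.InAx` over `Lam`); `avgClose α U₀ U′` = (1.35) «|(U′U₀)‾ʲ − Ū₀ʲ| < α on Λ_j», `j = 0, 1` (bond convention p. 77),
  through which the typed leaves read (1.145) (pv17 DIVERGENCE D-pv17.4); `avgClose166` = (1.66) on `Ω_j^{(j)}`; `Restricted` = (1.29)
  `Restr129` over `Lam`; `C162 B s` = the first member of (1.140) at constant `B·s`, level-wise; `InAPair` = the (1.40) pair.
* The fields not read by Proposition 7 ((1.36)–(1.39), (1.62), (1.146), (3.35), `act`, `fNorm`, `fGrad`, `InR`) are trivial data, as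
  in `B8Ineq145Lineage.lineageGF7`/`B8Prop7AdmittedFamily.admittedGF`.
[cite: Balaban1985RegularSpaces, (1.139)–(1.140) p.100, (1.144)–(1.145) p.100, (1.33)–(1.35) p.82, (1.29) p.81, (1.3)–(1.6) p.77] -/
def halfspaceGF (L : ℕ) (i₀ : Fin d) (𝔸 : Type) [CStarAlgebra 𝔸] (η : {η : ℝ // 0 < η}) : B8SectGH.GFData3 where
  Cfg := {U : Site d → Fin d → 𝔸ˣ // ∀ x κ, U x κ ∈ unitaryUnits 𝔸}
  Pert := Site d → Fin d → 𝔸ˣ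
  GT := Site d → 𝔸ˣ
  Src := Unit
  k := 1
  InA := fun α U₀ => InAk L 1 (η : ℝ) α (OmegaHS i₀) U₀.1
  Reg335 := fun _ _ => True
  InAAx := fun α U₀ U' =>
    InAk L 1 (η : ℝ) α (OmegaHS i₀) (U' * U₀.1) ∧ InAx L 1 (Lam i₀) U₀.1 (U' * U₀.1)
  avgClose := fun α U₀ U' => ∀ j, j ≤ 1 → ∀ (z : Site d) (κ : Fin d), BondTouches (Lam i₀ j) z κ →
    ‖((avgIter L (U' * U₀.1) j z κ : 𝔸ˣ) : 𝔸) - ((avgIter L U₀.1 j z κ : 𝔸ˣ) : 𝔸)‖ < α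
  avgClose166 := fun α U₀ U' => ∀ j, j ≤ 1 → ∀ (z : Site d) (κ : Fin d), (j = 0 ∨ BondTouches (Lam i₀ j) z κ) →
    ‖((tildIter L U₀.1 U' j z κ : 𝔸ˣ) : 𝔸) - 1‖ < α
  Restricted := fun U₀ u => Restr129 L 1 (Lam i₀) U₀.1 u
  act := fun U' u => gaugeAct (fun x => (u x)⁻¹) U'
  C136 := fun _ _ _ _ _ => True
  C137 := fun _ _ _ => True
  Landau := fun _ _ => True
  C139 := fun _ _ _ _ => True
  C162 := fun Bc s _ U₁ => ∃ A : Site d → Fin d → 𝔸, (∀ y κ, IsSelfAdjoint (A y κ)) ∧ U₁ = expCfg (iEta (η : ℝ) A) ∧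
    ∀ j, j ≤ 1 → ∀ (y : Site d) (κ : Fin d), BondTouches (OmegaHS i₀ j) y κ → (L : ℝ) ^ j * (η : ℝ) * ‖A y κ‖ < Bc * s
  fNorm := fun _ => 0
  LandauF := fun _ _ _ => True
  InAPair := fun α U₀ U₁ =>
    InAk L 1 (η : ℝ) α (OmegaHS i₀) U₀.1 ∧ InAk L 1 (η : ℝ) α (OmegaHS i₀) (U₁ * U₀.1)
  fGrad := fun _ _ => 0
  C140 := fun α₂ U₀ U₁ => ∃ A : Site d → Fin d → 𝔸, (∀ y κ, IsSelfAdjoint (A y κ)) ∧ U₁ = expCfg (iEta (η : ℝ) A) ∧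
    ∀ j, j ≤ 1 → Cond140 L (η : ℝ) α₂ j (OmegaHS i₀ j) U₀.1 A
  InR := fun _ _ => True

variable (d) in
/-- **`U₁ ↦ U′ = U₁^{u}`, the axial representative of (1.144)** with print's gauge transformation `u` for the half-space family — the one
satisfying (1.29) and putting `U′U₀ = (U₁U₀)^u` into `Ax_1(𝔅_1, U₀)` (p. 100 *"This gauge transformation is determined uniquely"*):
r05 g6's `B8Ineq145Lineage.u8` (`restr129_u8`, `inAx_u8`), acting in the moving frame (55) of [3] = (1.17).
[cite: Balaban1985RegularSpaces, (1.144) p.100, (1.29) p.81, (1.19) p.79, (1.17) p.78; Balaban1985Averaging, (55) p.27, (77) p.30, (87) p.31] -/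
def toAxialHS (L : ℕ) (hL1 : 1 ≤ L) (i₀ : Fin d) (𝔸 : Type) [CStarAlgebra 𝔸] :
    ∀ η : {η : ℝ // 0 < η}, (halfspaceGF d L i₀ 𝔸 η).Cfg → (halfspaceGF d L i₀ 𝔸 η).Pert → (halfspaceGF d L i₀ 𝔸 η).Pert :=
  fun _ U₀ U₁ => mgauge U₀.1 (u8 L hL1 i₀ U₀.1 U₁) U₁

/-- **PROPOSITION 7 FOR THE HALF-SPACE FAMILY, all inputs explicit** — for `d ≥ 2`, `L ≥ 2`, every `i₀`, `η > 0`, `0 < α₀ ≤ c(d,L)`,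
`0 < α₂ ≤ c(d,L)` (`cHS`), every `U(𝔸)`-valued `U₀ ∈ 𝔄_1({Ω_j}, α₀)` ((1.139), level-wise over `Ω₀ = T_η ⊃ Ω₁ = {0 ≤ x_{i₀}}`) and every
Hermitian `A` with (1.140) «on Ω_j», `j = 0, 1` (`Cond140`), with `U₁ = e^{iηA}` and print's `u = u8`: (i) `u` is `U(𝔸)`-valued;
(ii) (1.144) «U′U₀ = (U₁U₀)^u ∈ 𝔄_1({Ω_j}, α₀ + 3α₂)» (p40 g5's `B8Prop7ClassAkLocal.inAk_mulCfg_gaugeAct_hermitian_loc` BY NAME);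
(iii) (1.144) «… ∩ Ax_1(𝔅_1, U₀)» (`inAx_u8`) and (1.29) (`restr129_u8`); (iv) (1.145) ↦ (1.35): «|(U′U₀)‾ʲ_b − (Ū₀ʲ)_b| ≤ 201dL·α₂» at
every bond `b` on `Λ_j`, `j = 0, 1` (`norm_avgIter_u8_sub_le` with `b = α₂`). [cite: Balaban1985RegularSpaces, Prop. 7 (1.144)–(1.145) p.100] -/
theorem prop7_halfspace_explicit (hd : 2 ≤ d) {L : ℕ} (hL : 2 ≤ L) (hL1 : 1 ≤ L) (i₀ : Fin d) {η : ℝ} (hη : 0 < η)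
    {α₀ α₂ : ℝ} (hα₀ : 0 < α₀) (hα₀c : α₀ ≤ cHS d L) (hα₂ : 0 < α₂) (hα₂c : α₂ ≤ cHS d L)
    {U₀ : Site d → Fin d → 𝔸ˣ} (hU₀ : ∀ x κ, U₀ x κ ∈ unitaryUnits 𝔸) (h139 : InAk L 1 η α₀ (OmegaHS i₀) U₀)
    {A : Site d → Fin d → 𝔸} (hAh : ∀ y κ, IsSelfAdjoint (A y κ))
    (h140 : ∀ j, j ≤ 1 → Cond140 L η α₂ j (OmegaHS i₀ j) U₀ A) :
    (∀ x, u8 L hL1 i₀ U₀ (expCfg (iEta η A)) x ∈ unitaryUnits 𝔸) ∧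
    InAk L 1 η (α₀ + 3 * α₂) (OmegaHS i₀) (mgauge U₀ (u8 L hL1 i₀ U₀ (expCfg (iEta η A))) (expCfg (iEta η A)) * U₀) ∧
    InAx L 1 (Lam i₀) U₀ (mgauge U₀ (u8 L hL1 i₀ U₀ (expCfg (iEta η A))) (expCfg (iEta η A)) * U₀) ∧
    Restr129 L 1 (Lam i₀) U₀ (u8 L hL1 i₀ U₀ (expCfg (iEta η A))) ∧
    ∀ j, j ≤ 1 → ∀ (z : Site d) (κ : Fin d), BondTouches (Lam i₀ j) z κ →
      ‖((avgIter L (mgauge U₀ (u8 L hL1 i₀ U₀ (expCfg (iEta η A))) (expCfg (iEta η A)) * U₀) j z κ : 𝔸ˣ) : 𝔸)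
          - ((avgIter L U₀ j z κ : 𝔸ˣ) : 𝔸)‖ ≤ 201 * (d : ℝ) * (L : ℝ) * α₂ := by
  have hd1 : 1 ≤ d := le_trans (by norm_num) hd
  obtain ⟨hb, hBn, hBu, hα', hα3', hα4', h52, hsmall, hc₃, hsm, hαP, hαP3, hαP2, hP, h80₀, h80₂⟩ :=
    standingHS hd hL hL1 i₀ hη hα₀ hα₀c hα₂ hα₂c hU₀ h139 hAh h140
  have h₀ : ∀ y κ, U₀ y κ ∈ U1 𝔸 := fun y κ => unitaryUnits_le_U1 (hU₀ y κ)
  -- (i) `u` unitary-valued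
  have hu1 : ∀ x, u8 L hL1 i₀ U₀ (expCfg (iEta η A)) x ∈ unitaryUnits 𝔸 :=
    u8_mem_unitaryUnits hd1 hL hU₀ hBu hα' hα3' hα4' h52 hb hBn hsmall hc₃ hsm hαP hαP3 hαP2 hP hL1 i₀
  refine ⟨hu1, ?_, inAx_u8 L hL1 i₀ U₀ (expCfg (iEta η A)), restr129_u8 L hL1 i₀ U₀ (expCfg (iEta η A)),
    fun j hj z κ hbond => ?_⟩
  · -- (ii) the `𝔄_k`-clause of (1.144): p40's theorem for the unitary-valued `u`
    rw [mgauge_mul_eq_gaugeAct_mulCfg]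
    exact inAk_mulCfg_gaugeAct_hermitian_loc hη hL1 h₀ hAh hα₀.le h80₀ hα₂.le h80₂ h139 h140
      (fun x => unitaryUnits_le_U1 (hu1 x))
  · -- (iv) (1.145)/(1.35) on `Λ_j`, `j = 0, 1`
    have h := norm_avgIter_u8_sub_le hd1 hL hU₀ hBu hα' hα3' hα4' h52 hb hBn hsmall hc₃ hsm hαP hαP3 hαP2 hP hL1 i₀ hj hbond
    rw [pow_one] at h
    linarith

variable (d) in
/-- **PROPOSITION 7 (REPAIRED LEAF) PROVED FOR THE HALF-SPACE FAMILY**: `B8Ineq145.Prop7RepairedC (202·d·L) (halfspaceGF d L i₀ 𝔸)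
(toAxialHS d L _ i₀ 𝔸)` — *"If the configurations U₀, A satisfy (1.139), (1.140), then for α₀, α₂ sufficiently small we have
U′U₀ = (U₁U₀)^u ∈ 𝔄_k({Ω_j}, α₀ + 3α₂) ∩ Ax_k(𝔅_k, U₀), (1.144)  |(U′U₀)‾ʲ − Ū₀ʲ| … on Ω_j^{(j)} (1.145)"* with (1.145) read as (1.35) on
`Λ_j` at the REPAIRED constant `C(d, L)·α₂ = 202dL·α₂` (cell GAPS G-B8-01: print's `2α₂` is false on the bonds crossing `∂Λ₁` — §5),
for EVERY `η > 0`, every `d ≥ 2`, `L ≥ 2`, `i₀`, every C⋆-algebra `𝔸`, threshold `c = cHS d L`.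
[cite: Balaban1985RegularSpaces, Prop. 7 (1.144)–(1.145) p.100, (1.35) p.82, (1.31) p.82] -/
theorem prop7RepairedC_halfspace (hd : 2 ≤ d) {L : ℕ} (hL : 2 ≤ L) (hL1 : 1 ≤ L) (i₀ : Fin d) :
    B8Ineq145.Prop7RepairedC (202 * (d : ℝ) * L) (halfspaceGF d L i₀ 𝔸) (toAxialHS d L hL1 i₀ 𝔸) := by
  dsimp only [B8Ineq145.Prop7RepairedC, halfspaceGF, toAxialHS]
  refine ⟨cHS d L, cHS_pos (le_trans (by norm_num) hd) hL1, ?_⟩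
  intro i α₀ α₂ hα₀ hα₀c hα₂ hα₂c U₀ U₁ h139 h140
  obtain ⟨A, hAh, hU₁, h140⟩ := h140
  subst hU₁
  have hη : (0 : ℝ) < (i : ℝ) := i.2
  obtain ⟨-, hAk, hAx, -, hcl⟩ := prop7_halfspace_explicit hd hL hL1 i₀ hη hα₀ hα₀c hα₂ hα₂c U₀.2 h139 hAh h140
  refine ⟨⟨hAk, hAx⟩, fun j hj z κ hbond => ?_⟩
  have hd0 : (0 : ℝ) < d := by exact_mod_cast (lt_of_lt_of_le (by norm_num) hd)
  have hL0 : (0 : ℝ) < L := by exact_mod_cast (lt_of_lt_of_le (by norm_num) hL1)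
  have : 0 < (d : ℝ) * L * α₂ := by positivity
  exact (hcl j hj z κ hbond).trans_lt (by linarith)

variable (d) in
/-- … hence for EVERY constant `C ≥ 202dL` (`B8Ineq145.prop7RepairedC_mono`; (1.35) is monotone in its constant on these carriers).
[cite: Balaban1985RegularSpaces, Prop. 7 (1.144)–(1.145) p.100] -/
theorem prop7RepairedC_halfspace_of_le (hd : 2 ≤ d) {L : ℕ} (hL : 2 ≤ L) (hL1 : 1 ≤ L) (i₀ : Fin d) {C : ℝ}
    (hC : 202 * (d : ℝ) * L ≤ C) :
    B8Ineq145.Prop7RepairedC C (halfspaceGF d L i₀ 𝔸) (toAxialHS d L hL1 i₀ 𝔸) := by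
  refine B8Ineq145.prop7RepairedC_mono hC _ _ (fun i a a' U₀ U' haa' h => ?_) (prop7RepairedC_halfspace d hd hL hL1 i₀)
  dsimp only [halfspaceGF] at h ⊢
  exact fun j hj z κ hb => (h j hj z κ hb).trans_le haa'

end Model

/-! ## §5 The typed PRINTED leaf is false for the half-space family (`d = 4`, `L = 3`, `𝔸 = ℂ`): the witness of
`B8Ineq145Lineage` §5 in the `GFData3` packaging -/

section Printed

open Complex (I)

/-- `1 ≤ 3`. [folklore] -/
private theorem one_le_three : (1 : ℕ) ≤ 3 := by norm_num

/-- The witness field `U₁ ≡ e^{iθ}` IS «U₁ = e^{iηA}» (`η = 1`) for the constant Lie-algebra valued `A ≡ θ` (`𝔸 = ℂ`: Hermitian = real).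
[cite: Balaban1985RegularSpaces, (1.140) p.100 («U₁ = e^{iηA}»)] -/
private theorem cst_eI_eq_expCfg (θ : ℝ) :
    (B8Ineq145Lineage.cst (eI θ) : Site 4 → Fin 4 → ℂˣ) = expCfg (iEta (1 : ℝ) (fun _ _ => ((θ : ℝ) : ℂ))) := by
  funext x κ
  show eI θ = expUnit (iEta 1 (fun (_ : Site 4) (_ : Fin 4) => ((θ : ℝ) : ℂ)) x κ)
  rw [eI]
  congr 1
  simp [iEta]

/-- **THE TYPED PRINTED PROPOSITION 7 (`B8SectGH.Prop7PrintedR`, pv17's faithful form, constant `2α₂`) IS FALSE FOR THE HALF-SPACE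
FAMILY** `halfspaceGF 4 3 0 ℂ` (`d = 4`, `L = 3`, `i₀ = 0`, `𝔸 = ℂ`, print's `u = u8`): for every threshold `c > 0` take `α₀ = α₂ =
min{c, 1/4}`, `η = 1`, `U₀ = 1` ((1.139) for every family: `B8Ineq145Lineage.hyp139`), `U₁ ≡ e^{iθ} = e^{iηA}` with the constant Hermitian
`A ≡ θ`, `3θ = (27/28)α₂` ((1.140), all three members at both levels: `Lʲ|θ| < α₂`, the covariant derivatives of a constant at the
flat background vanish); then the conclusion (1.145) ↦ `avgClose (2α₂)` fails on the level-1 bond `⟨y, y + e₀⟩`, `y₀ = −1`, crossing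
into `Λ₁` (r05 g6's `B8Ineq145Lineage.ineq145_fails_lineage`: the value is `2 sin((9/8)α₂) > 2α₂`).  Contrast: the same typed
sentence HOLDS for the admitted family (`B8Prop7AdmittedFamily.prop7PrintedR_admitted`), and the REPAIRED leaf holds here (§4).
[cite: Balaban1985RegularSpaces, Prop. 7 (1.144)–(1.145) p.100, (1.31) p.82] -/
theorem not_prop7PrintedR_halfspace :
    ¬ B8SectGH.Prop7PrintedR (halfspaceGF 4 3 (0 : Fin 4) ℂ) (toAxialHS 4 3 one_le_three (0 : Fin 4) ℂ) := by
  rintro ⟨c, hc, H⟩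
  set α₂ : ℝ := min c (1 / 4) with hα₂
  have h0 : 0 < α₂ := lt_min hc (by norm_num)
  have h1 : α₂ ≤ 1 / 4 := min_le_right _ _
  have hc2 : α₂ ≤ c := min_le_left _ _
  set θ : ℝ := 9 / 28 * α₂ with hθdef
  have hθ : (3 : ℝ) * θ = 27 / 28 * α₂ := by rw [hθdef]; ring
  have hθpos : 0 < θ := by positivity
  -- the data: `η = 1`, `U₀ = 1`, `U₁ ≡ e^{iθ} = e^{iηA}` with `A ≡ θ`
  let U₀ : (halfspaceGF 4 3 (0 : Fin 4) ℂ ⟨1, one_pos⟩).Cfg := ⟨1, fun _ _ => (unitaryUnits ℂ).one_mem⟩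
  let A : Site 4 → Fin 4 → ℂ := fun _ _ => ((θ : ℝ) : ℂ)
  have hAh : ∀ (y : Site 4) (κ : Fin 4), IsSelfAdjoint (A y κ) := fun _ _ => by
    show star ((θ : ℝ) : ℂ) = θ
    rw [Complex.star_def, Complex.conj_ofReal]
  have hnormA : ∀ (y : Site 4) (κ : Fin 4), ‖A y κ‖ = θ := fun _ _ => by
    show ‖((θ : ℝ) : ℂ)‖ = θ
    rw [Complex.norm_real, Real.norm_eq_abs, abs_of_pos hθpos]
  -- (1.139) for `U₀ = 1`
  have hInA : InAk 3 1 (1 : ℝ) α₂ (OmegaHS (0 : Fin 4)) (1 : Site 4 → Fin 4 → ℂˣ) := hyp139 3 one_le_three 1 one_pos h0 _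
  -- (1.140), all three members, at the levels `j = 0, 1`
  have hgrad : ∀ (κ τ : Fin 4) (y : Site 4), covDerivFwd (1 : ℝ) (1 : Site 4 → Fin 4 → ℂˣ) κ (fun z => A z τ) y = 0 :=
    fun κ τ y => hyp140_grad 1 _ κ y
  have hplaq : plaqCovDeriv (1 : ℝ) (1 : Site 4 → Fin 4 → ℂˣ) A = fun _ _ _ => 0 := by
    funext μ ν x
    rw [plaqCovDeriv_eq_covDerivFwd, hgrad μ ν x, hgrad ν μ x, sub_zero]
  have hdiv : ∀ (μ : Fin 4) (y : Site 4), pdiv (1 : ℝ) (1 : Site 4 → Fin 4 → ℂˣ) (plaqCovDeriv (1 : ℝ) 1 A) μ y = 0 := by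
    intro μ y
    rw [hplaq]
    simp [pdiv, covDeriv]
  have hC140 : (halfspaceGF 4 3 (0 : Fin 4) ℂ ⟨1, one_pos⟩).C140 α₂ U₀ (B8Ineq145Lineage.cst (eI θ)) := by
    refine ⟨A, hAh, cst_eI_eq_expCfg θ, fun j hj => ⟨fun y τ _ => ?_, fun y κ τ _ => ?_, fun y μ _ => ?_⟩⟩
    · rw [hnormA y τ]
      interval_cases j
      · norm_num; linarith
      · norm_num; linarith
    · show ‖covDerivFwd (1 : ℝ) (1 : Site 4 → Fin 4 → ℂˣ) κ (fun z => A z τ) y‖ < _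
      rw [hgrad κ τ y, norm_zero]; positivity
    · show ‖pdiv (1 : ℝ) (1 : Site 4 → Fin 4 → ℂˣ) (plaqCovDeriv (1 : ℝ) 1 A) μ y‖ < _
      rw [hdiv μ y, norm_zero]; positivity
  obtain ⟨-, havg⟩ := H ⟨1, one_pos⟩ α₂ α₂ h0 hc2 h0 hc2 U₀ (B8Ineq145Lineage.cst (eI θ)) hInA hC140
  -- the conclusion (1.145) ↦ `avgClose (2α₂)` at the crossing bond `⟨y, y + e₀⟩`, `y₀ = −1`
  let y : Site 4 := fun i => if i = 0 then -1 else 0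
  have hy : y 0 = -1 := by simp [y]
  have htouch : BondTouches (Lam (0 : Fin 4) 1) y 0 := Or.inr (by
    show 0 ≤ (y + e (0 : Fin 4)) 0
    simp [y, e_apply])
  have hlt := havg 1 le_rfl y 0 htouch
  have hgt := ineq145_fails_lineage (0 : Fin 4) h0 h1 hθ y hy
  exact lt_irrefl _ (hlt.trans hgt)

/-- **G-B8-01 LOCATED, BOTH WAYS, ON ONE FAMILY** (`d = 4`, `L = 3`, `𝔸 = ℂ`, the half-space family with print's `u`): the typed printed
Proposition 7 (constant `2α₂` in (1.145)) is FALSE, the repaired Proposition 7 (constant `C(d, L)·α₂`, here `C = 2424 = 202·4·3`) is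
TRUE — the erratum of the display (1.145) is exactly its constant on the bonds crossing `∂Λ_j` (cell GAPS G-B8-01: «constants only»;
the downstream Theorem 2 consumes (1.35) at any fixed constant, `B8Ineq145.thm2_after_prop7RepairedC`).
[cite: Balaban1985RegularSpaces, Prop. 7 (1.144)–(1.145) p.100, (1.31) p.82, Thm 2 p.83] -/
theorem prop7_halfspace_located :
    ¬ B8SectGH.Prop7PrintedR (halfspaceGF 4 3 (0 : Fin 4) ℂ) (toAxialHS 4 3 one_le_three (0 : Fin 4) ℂ) ∧
      B8Ineq145.Prop7RepairedC 2424 (halfspaceGF 4 3 (0 : Fin 4) ℂ) (toAxialHS 4 3 one_le_three (0 : Fin 4) ℂ) :=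
  ⟨not_prop7PrintedR_halfspace,
    prop7RepairedC_halfspace_of_le 4 (by norm_num) (by norm_num) one_le_three (0 : Fin 4) (by norm_num)⟩

end Printed



end Literature.MathematicalPhysics.QuantumFieldTheory.Balaban1983to89.B8Prop7HalfSpace

end
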